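import Literature.Analysis.FluidPDE.AlternatingSawtoothShearMixing
import Literature.Analysis.FunctionSpaces.TorusPeriodization
import HarnessLib

/-!
# The cumulative Batchelor law for a deterministically driven passive scalar
# (Liss–Mattingly 2026: Theorems 2.1–2.4, 3.1–3.2)

K. L. Liss, J. C. Mattingly, *The Batchelor spectrum for a deterministically driven passive
scalar*, arXiv:2603.08904 (v1, 9 Mar 2026, 57 pp.; the only version; page numbers below are those
of the arXiv PDF, page-confirmed 2026-08-27). [`LissMattingly2026`]

Named facts (Literature is sorry-free, D-0014): `LissMattingly2026_thm31`, `_thm32`, `_thm21`,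
`_thm22`, `_thm23`, `_thm24` are `def … : Prop`. The velocity field is the alternating sawtooth shear
`u_α` of Elgindi–Liss–Mattingly 2025 (`AlternatingSawtoothShearMixing.lean`, whose explicit flow maps
are reused — nothing is redeclared), the carrier replayed across scales by the route
`Summits/AnomalousDissipation/…/Theses/SawtoothPulseCascade`. To our knowledge (source, p. 1) this is
the first Batchelor-law theorem with DETERMINISTIC forcing; the barrier file
`Barriers/AnomalousDissipation/ObukhovCorrsinThreshold.lean` cites Thms. 2.2–2.4 in prose (caveat
(vi)); no statement had been typed.

## Source, verbatim (arXiv:2603.08904v1)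

* p. 3–4, the field: "Let `U₁(x,y) = (0, 2|x - 1/2|)` and `U₂(x,y) = (2|y - 1/2|, 0)`. We consider
  the alternating 'sawtooth' shear flow `u_α : [0,∞) × 𝕋² → ℝ²`, defined for an amplitude `α > 0` by
  `u_α(t,x,y) = αU₁(x,y)` for `t ∈ [0,1/2)`, `αU₂(x,y)` for `t ∈ [1/2,1)` and extended periodically in
  time for `t ≥ 1`. … It therefore generates a well-defined Lebesgue measure-preserving flow map
  `Φ^α_{s,t} : 𝕋² → 𝕋²` [(2.1)] … for the time-one flow map `T_α := Φ^α_{0,1}`, there exist constants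
  `c, C > 0` depending on `α` such that `|∫_{𝕋²} (f ∘ T_α^{-n})(z) g(z) dz| ≤ C e^{-cn} ‖f‖_{C¹} ‖g‖_{C¹}`
  (2.2) for every mean-zero `f, g ∈ C¹(𝕋²)` and `n ∈ ℕ`" [cited from [37] = Elgindi–Liss–Mattingly].
* (2.3)–(2.4) p. 4: `∂ₜρ + u_α·∇ρ = F`, `ρ|_{t=0} = ρ₀`, `F` spatially smooth with
  `∫_{𝕋²} F(·,z) dz ≡ 0`. (2.5) p. 4: for a mean-zero `f ∈ C^∞(𝕋²)` with `‖f‖_{L²} = 1`,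
  `K_α(ρ) = ρ ∘ T_α⁻¹ + f`; `ρ_n = K_α(ρ_{n-1})`. (2.7) p. 5: `ρ_∞ = ∑_{n=0}^∞ f ∘ T_α^{-n}`.
* **Theorem 2.1** (p. 5): "Fix any mean-zero `f ∈ C^∞(𝕋²)` with `‖f‖_{L²} = 1`. For all `α`
  sufficiently large, the following hold: (1) The series (2.7) defines a distribution
  `ρ_∞ ∈ (⋂_{s>0} H^{-s}) \ L²` satisfying `K_α(ρ_∞) = ρ_∞`, where `K_α` is extended to a map on
  `H^{-1}(𝕋²)` by duality. (2) For every mean-zero `ρ₀ ∈ C¹(𝕋²)`, we have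
  `lim_{n→∞} ‖K_α^n(ρ₀) - ρ_∞‖_{H^{-s}} = 0` for all `s > 0`. (3) The cumulative Batchelor law holds
  for `ρ_∞` in that there exists `C ≥ 1` independent of `α` and `N_α ≥ 1` such that
  `(1/C) log N / log α ≤ ‖Π_{≤N} ρ_∞‖²_{L²} ≤ C log N / log α` (2.8) for every `N ≥ N_α`, where
  `Π_{≤N}` denotes the projection onto wavenumbers `k ∈ ℤ²` with `|k| ≤ N`."
* **Theorem 2.2** (p. 7): "Let `F : [0,∞) × 𝕋² → ℝ` be a smooth, time-one periodic function
  satisfying the mean-zero condition (2.4). For `α` sufficiently large, there exists a time-one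
  periodic distribution `ρ_∞ ∈ L^∞([0,∞); H^{-s})` `∀ s > 0` that solves (2.3) and attracts all
  sufficiently smooth initial data. That is, for every mean-zero `ρ₀ ∈ C¹(𝕋²)`, the unique solution
  `ρ` of (2.3) satisfies `lim_{t→∞} ‖ρ(t) - ρ_∞(t)‖_{H^{-s}} = 0` for all `s > 0`. Moreover, there
  exists `C_α ≥ 1` such that `‖Π_{≤N} ρ_∞(t)‖²_{L²} ≤ C_α log N` (2.11) for every `t ≥ 0` and `N ≥ 2`."
* **Theorem 2.3** (p. 7): "Let `F : [0,∞) × 𝕋² → ℝ` be a time-one periodic function, defined for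
  `t ∈ [0,1)` by `F(t,x,y) = η(t)h(y)` (2.12), where `h ∈ C^∞(𝕋)` is a mean-zero function with
  `‖h‖_{L²(𝕋)} = 1` and `η ∈ C^∞([0,1]; [0,∞))` is a nonzero function supported in `(1/2,1)`. Then,
  the limit cycle `ρ_∞` guaranteed by Theorem 2.2 satisfies the cumulative Batchelor law: there
  exists `C ≥ 1` independent of `α` and `N_α ≥ 1` such that
  `(1/C) log N / log α ≤ ‖Π_{≤N} ρ_∞(t)‖²_{L²} ≤ C log N / log α` (2.13) for all `t ≥ 0` and
  `N ≥ N_α`. In particular, `ρ_∞(t) ∉ L²` for every `t ≥ 0`."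
* p. 7: "`(Φ^α_{s,t})⁻¹ = ϕ^α_{t,s}` … By Duhamel's formula, the unique solution of (2.3) is then
  given by `ρ(t) = ρ₀ ∘ ϕ^α_{t,0} + ∫₀ᵗ F_s ∘ ϕ^α_{t,s} ds`", `F_s(z) = F(s,z)`.
* (2.17) p. 8: `T_N := ∫₀¹ ⟨Π_{≤N} ρ_∞(t), Π_{≤N}(u_α·∇ρ_∞(t))⟩_{L²} dt = ∫₀¹ ⟨Π_{≤N} ρ_∞(t), F_t⟩_{L²} dt`
  ("time-averaged advective `L²`-energy flux out of Fourier modes with `|k| ≤ N`").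
  **Theorem 2.4** (p. 8): "Let `F` and `ρ_∞` be as in Theorem 2.3. Then, the limit `lim_{N→∞} T_N`
  exists and is strictly positive."
* **Theorem 3.1** (Quantitative-in-`α` exponential mixing, p. 9): "There exist constants `c, C > 0`
  such that for all `α` sufficiently large, mean-zero `f, g ∈ W^{1,∞}(𝕋²)`, `n ∈ ℕ`, and
  `t ∈ [1/2 + α^{-1/2}, 1]` the following estimates hold:
  `|∫_{𝕋²} f ∘ T_α^{-n}(z) g(z) dz| ≤ C e^{-cn log α} ‖f‖_{W^{1,∞}} ‖g‖_{W^{1,∞}}` (3.1a),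
  `|∫_{𝕋²} f ∘ T_α^{-n}(z) g ∘ Φ^α_{0,t}(z) dz| ≤ C e^{-cn log α} ‖f‖_{W^{1,∞}} ‖g‖_{W^{1,∞}}` (3.1b)."
* (3.3) p. 10: for an even smooth bump `φ : ℝ² → [0,∞)` supported in `[-1,1]²` with `∫ φ = 1`,
  `φ_N(z) = ∑_{m ∈ ℤ²} N² φ(N(z+m))`, `P_{≤N} f(z) = ∫_{𝕋²} φ_N(z - z̄) f(z̄) dz̄`.
  **Theorem 3.2** (Projected exponential mixing, p. 10): "There exist constants `c, C > 0` such that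
  for all `α` sufficiently large, mean-zero `f, g ∈ W^{1,∞}(𝕋²)`, and `m, n ∈ ℕ` we have
  `|∫_{𝕋²} P_{≤N}(f ∘ T_α^{-n})(z) P_{≤N}(g ∘ T_α^{-m})(z) dz| ≤ C e^{-c|m-n| log α} ‖f‖_{W^{1,∞}} ‖g‖_{W^{1,∞}}`
  (3.4) for every `N ≥ 1`."

## Rendering (design choices; deviations from print are WEAKENINGS by omission, recorded here)

1. The field. `αU₁ = (0, 2α|x - 1/2|)`, `αU₂ = (2α|y - 1/2|, 0)` are Elgindi–Liss–Mattingly's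
   `V_{-α}`, `H_{-α}` (theirs carry the factor `-2α`), with the same schedule (vertical shear on
   `[0,1/2)`, horizontal on `[1/2,1)`); so `u_α = ElgindiLissMattingly2025.field (-α)`,
   `T_α = Φ^α_{0,1} = periodMap (-α)`, `T_α⁻¹ = periodInv (-α)`, `Φ^α_{0,t} = flowMap (-α) t`,
   `ϕ^α_{t,0} = (Φ^α_{0,t})⁻¹ = flowInv (-α) t` and, by the flow property of the periodic field,
   `ϕ^α_{t,s} = Φ^α_{0,s} ∘ (Φ^α_{0,t})⁻¹ = flowMap (-α) s ∘ flowInv (-α) t` — the abbreviations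
   `LissMattingly2026.field/timeOneMap/timeOneInv/flow/backFlow` below. "`α` sufficiently large":
   `∃ α₀, ∀ α ≥ α₀` over REAL `α` (the source does not restrict to even integers).
2. `W^{1,∞}(𝕋²)` = bounded Lipschitz functions; `‖f‖_{W^{1,∞}} = ‖f‖_∞ + ‖∇f‖_∞` is rendered by the
   tree's `FunctionSpaces.eBoundedHolderNorm 1 f = sup|f| + Lip(f)` (intrinsic product metric of
   `𝕋²`; equivalent up to an absolute factor absorbed by `C`), membership `MemBoundedHolder 1`;
   likewise `‖·‖_{C¹}`. "mean-zero" = `∫ f = 0`.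
3. Distributions through FOURIER COEFFICIENTS. `ρ_∞ = ∑_n f ∘ T_α^{-n}` is not a function
   (`ρ_∞ ∉ L²`); it is typed by its Fourier coefficients
   `ρ̂_∞(k) = ∑_n 𝓕(f ∘ T_α^{-n})(k)` (`LissMattingly2026.rhoInfCoeff`; each series converges
   absolutely by (3.2), which is clause (1a) below), and every norm in the statements is a function of
   coefficients: `‖Π_{≤N} ρ‖²_{L²} = ∑_{|k| ≤ N} |ρ̂(k)|²` (`lowModeMass N`), `‖ρ‖²_{H^{-s}} =
   ∑_k ⟨k⟩^{-2s} |ρ̂(k)|²` (`coeffSobolevNormSq (-s)`, the tree's `sobolevWeight`, i.e. the same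
   weights as `FunctionSpaces.Torus.eSobolevNorm`; on mean-zero objects equivalent to the homogeneous
   norm), `ρ ∈ L² ⇔ ∑_k |ρ̂(k)|² < ∞` (Parseval). `K_α^n(ρ₀) = ρ₀ ∘ T_α^{-n} + ∑_{m<n} f ∘ T_α^{-m}`
   (iterate (2.5)), a `C¹` function, enters through its coefficients `iterCoeff`.
4. Theorem 2.1 (1) is typed as: (1a) for every `k` the series defining `ρ̂_∞(k)` is summable;
   (1b) `‖ρ_∞‖_{H^{-s}} < ∞` for every `s > 0`; (1c) `∑_k |ρ̂_∞(k)|² = ∞` (`ρ_∞ ∉ L²`); (1d) the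
   fixed-point identity `K_α(ρ_∞) = ρ_∞` BY DUALITY against `C¹` test functions:
   `⟨ρ_∞, g⟩ = ⟨ρ_∞, g ∘ T_α⟩ + ∫ f g` with `⟨ρ_∞, g⟩ := ∑_n ∫ (f ∘ T_α^{-n}) g` (summable), which is
   what "`K_α` extended by duality" means since `T_α` preserves Lebesgue measure
   (`⟨ρ ∘ T_α⁻¹, g⟩ = ⟨ρ, g ∘ T_α⟩`); the source pairs with `H¹` — `C¹` tests are a sub-class
   (weakening, recorded). (2) and (3) verbatim in coefficients; `N` ranges over naturals `≥ N_α`.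
   Quantifier order as printed: `f` first, then "`C ≥ 1` independent of `α`", then `α₀`, then
   `N_α`.
5. Theorems 2.2–2.4. "The unique solution `ρ` of (2.3)" for `ρ₀ ∈ C¹`, smooth `F` and the Lipschitz
   field is the printed Duhamel formula `ρ(t) = ρ₀ ∘ ϕ_{t,0} + ∫₀ᵗ F_s ∘ ϕ_{t,s} ds` (p. 7), typed as
   the explicit function `LissMattingly2026.solution α F ρ₀`. The limit cycle `ρ_∞(t)` is an
   EXISTENTIAL time-one-periodic family of coefficient sequences `ρinf : ℝ → (ℤ² → ℂ)` with
   `sup_{t ≥ 0} ‖ρ_∞(t)‖_{H^{-s}} < ∞` for all `s > 0` which ATTRACTS every mean-zero `C¹` datum in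
   every `H^{-s}` (this pins `ρ_∞` down: two periodic attracting families coincide); the clause
   "solves (2.3)" (in distributions) is NOT transcribed (weakening by omission: the typed object is
   characterised as the common `H^{-s}`-limit of all solutions, which is how it is used in
   Thms. 2.3–2.4). Theorem 2.3/2.4 restate the Theorem-2.2 package for the special forcing (2.12)
   (the limit cycle "guaranteed by Theorem 2.2") and add (2.13), `ρ_∞(t) ∉ L²`, and the flux limit.
   The flux `T_N` is typed through the printed balance identity (2.17),
   `T_N = ∫₀¹ ⟨Π_{≤N} ρ_∞(t), F_t⟩ dt = ∫₀¹ ∑_{|k|≤N} Re(ρ̂_∞(t,k) conj(F̂_t(k))) dt` (Parseval on the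
   modes `|k| ≤ N`), the form in which the source evaluates it (§3; the left member of (2.17) involves
   `u_α·∇ρ_∞`, a distribution). The forcing class of Thm. 2.2: `F` jointly smooth on `ℝ × 𝕋²`
   (`Torus.IsSmoothSpaceTimeOn univ`), time-one periodic, `∫ F(t,·) = 0` for all `t`; of Thm. 2.3:
   `F(t,x,y) = η(t - ⌊t⌋) h(y)` with `h ∈ C^∞(𝕋)` mean-zero, `‖h‖_{L²(𝕋)} = 1`,
   `η ∈ C^∞(ℝ)`, `η ≥ 0`, `η ≢ 0`, `η = 0` off a compact `[a,b] ⊂ (1/2,1)` (the reading of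
   "supported in `(1/2,1)`" under which the periodic extension is smooth).
6. Theorem 3.2: `P_{≤N}` is typed for ANY admissible bump `φ` (even, smooth, nonnegative, supported
   in `[-1,1]²`, `∫ φ = 1`), quantified before the constants (the source fixes one such `φ`; the
   constants may depend on it): `φ_N = Torus.periodize (z ↦ N² φ(Nz))`
   (`FunctionSpaces.Torus.periodize`, the lattice sum `∑_m g(z + m)`), `P_{≤N} f(z) = ∫ φ_N(z - z̄) f(z̄) dz̄`.
7. NOT typed: Remarks 2.1–2.6 (context; Rmk. 2.3 = OPEN extension to `κ > 0`), Remark 3.1 ((3.2),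
   a corollary of (3.1a)), Lemmas 3.3–3.4, §§4–5 (anisotropic-norm transfer-operator machinery,
   Theorem 4.1, Propositions 4.1–4.2).

## References

* K. L. Liss, J. C. Mattingly, arXiv:2603.08904v1 (2026): §2 pp. 3–8 (Thms. 2.1–2.4, (2.1)–(2.17)),
  §3.1 pp. 9–10 (Thms. 3.1–3.2, (3.3)). [`LissMattingly2026`]
* T. M. Elgindi, K. Liss, J. C. Mattingly, Duke Math. J. 174 (2025) = arXiv:2304.05374v1, §1 p. 2
  (the field `u_α`; typed in `AlternatingSawtoothShearMixing.lean`). [`ElgindiLissMattingly2025`]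
-/

noncomputable section

namespace Literature.Analysis.FluidPDE

open _root_.MeasureTheory _root_.Set _root_.Filter
open scoped NNReal ENNReal Topology ContDiff

namespace LissMattingly2026

open FunctionSpaces

/-! ## The field, its time-one map and flows (abbreviations of the Elgindi–Liss–Mattingly objects) -/

/-- Liss–Mattingly's `u_α = αU₁` on `[0,1/2)`, `αU₂` on `[1/2,1)`, `U₁ = (0, 2|x - 1/2|)`,
`U₂ = (2|y - 1/2|, 0)` (pp. 3–4) — Elgindi–Liss–Mattingly's field with amplitude `-α` (module
docstring 1.). [cite: LissMattingly2026, §2 pp. 3–4 (u_α)] -/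
def field (α : ℝ) : ℝ → UnitAddTorus (Fin 2) → EuclideanSpace ℝ (Fin 2) :=
  ElgindiLissMattingly2025.field (-α)

/-- The time-one flow map `T_α := Φ^α_{0,1}` (p. 4). [cite: LissMattingly2026, §2 p. 4 (T_α)] -/
def timeOneMap (α : ℝ) : UnitAddTorus (Fin 2) → UnitAddTorus (Fin 2) :=
  ElgindiLissMattingly2025.periodMap (-α)

/-- The inverse time-one map `T_α⁻¹` (so `f ∘ T_α^{-n} = f ∘ (timeOneInv α)^[n]`, (2.2), (2.5), (2.7)).
[cite: LissMattingly2026, §2 p. 4 ((2.2), T_α^{-n}) and (2.5)] -/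
def timeOneInv (α : ℝ) : UnitAddTorus (Fin 2) → UnitAddTorus (Fin 2) :=
  ElgindiLissMattingly2025.periodInv (-α)

/-- The flow map `Φ^α_{0,t}` from time `0` to time `t ≥ 0` ((2.1) p. 4). [cite: LissMattingly2026, (2.1) p. 4] -/
def flow (α t : ℝ) : UnitAddTorus (Fin 2) → UnitAddTorus (Fin 2) :=
  ElgindiLissMattingly2025.flowMap (-α) t

/-- The backward map `ϕ^α_{t,s} = (Φ^α_{s,t})⁻¹ = Φ^α_{0,s} ∘ (Φ^α_{0,t})⁻¹` (p. 7), `0 ≤ s ≤ t`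
(flow property of the time-periodic field; module docstring 1.). [cite: LissMattingly2026, §2.2.1 p. 7 (ϕ^α_{t,s})] -/
def backFlow (α t s : ℝ) : UnitAddTorus (Fin 2) → UnitAddTorus (Fin 2) :=
  ElgindiLissMattingly2025.flowMap (-α) s ∘ ElgindiLissMattingly2025.flowInv (-α) t

/-! ## Fourier-side functionals (module docstring 3.) -/

/-- `𝓕(g)(k)`, the `k`-th Fourier coefficient of a real function on `𝕋²` (through its
complexification, as everywhere in the tree). [folklore] -/
def coeff (g : UnitAddTorus (Fin 2) → ℝ) (k : Fin 2 → ℤ) : ℂ :=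
  UnitAddTorus.mFourierCoeff (fun z => (g z : ℂ)) k

/-- The `k`-th Fourier coefficient of the `n`-th term `f ∘ T_α^{-n}` of (2.7).
[cite: LissMattingly2026, (2.7) p. 5] -/
def termCoeff (α : ℝ) (f : UnitAddTorus (Fin 2) → ℝ) (n : ℕ) (k : Fin 2 → ℤ) : ℂ :=
  coeff (fun z => f ((timeOneInv α)^[n] z)) k

/-- **`ρ̂_∞(k) = ∑_{n ≥ 0} 𝓕(f ∘ T_α^{-n})(k)`**, the Fourier coefficients of the formal series
`ρ_∞ = ∑_n f ∘ T_α^{-n}` of (2.7) (junk `0` where the series is not summable; summability is clause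
(1a) of the typed Theorem 2.1). [cite: LissMattingly2026, (2.7) p. 5 and Thm. 2.1 (1)] -/
def rhoInfCoeff (α : ℝ) (f : UnitAddTorus (Fin 2) → ℝ) (k : Fin 2 → ℤ) : ℂ :=
  ∑' n : ℕ, termCoeff α f n k

/-- The Fourier coefficients of the `n`-th iterate `K_α^n(ρ₀) = ρ₀ ∘ T_α^{-n} + ∑_{m<n} f ∘ T_α^{-m}`
of the discrete-time model (2.5). [cite: LissMattingly2026, (2.5) p. 4 (K_α, ρ_n = K_α(ρ_{n-1}))] -/
def iterCoeff (α : ℝ) (f ρ₀ : UnitAddTorus (Fin 2) → ℝ) (n : ℕ) (k : Fin 2 → ℤ) : ℂ :=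
  coeff (fun z => ρ₀ ((timeOneInv α)^[n] z)) k + ∑ m ∈ Finset.range n, termCoeff α f m k

/-- The wavenumbers `k ∈ ℤ²` with `|k| ≤ N` (a finite set). [cite: LissMattingly2026, Thm. 2.1 (3) p. 5 (Π_{≤N})] -/
def lowModes (N : ℕ) : Finset (Fin 2 → ℤ) :=
  (Fintype.piFinset fun _ => Finset.Icc (-(N : ℤ)) N).filter fun k => Torus.freqNormSq k ≤ (N : ℝ) ^ 2

/-- **`‖Π_{≤N} ρ‖²_{L²} = ∑_{|k| ≤ N} |ρ̂(k)|²`** for an object given by its Fourier coefficients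
`c` (Parseval on the finitely many modes `|k| ≤ N`). [cite: LissMattingly2026, Thm. 2.1 (3) p. 5 ((2.8), Π_{≤N})] -/
def lowModeMass (N : ℕ) (c : (Fin 2 → ℤ) → ℂ) : ℝ :=
  ∑ k ∈ lowModes N, ‖c k‖ ^ 2

/-- **`‖ρ‖²_{H^{s}} = ∑_k ⟨k⟩^{2s} |ρ̂(k)|² ∈ [0,∞]`** for an object given by its Fourier
coefficients (the weights `FunctionSpaces.Torus.sobolevWeight` of the tree's `eSobolevNorm`; used
with `s < 0`). [cite: LissMattingly2026, Thm. 2.1 (1)–(2) p. 5 (H^{-s})] -/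
def coeffSobolevNormSq (s : ℝ) (c : (Fin 2 → ℤ) → ℂ) : ℝ≥0∞ :=
  ∑' k : Fin 2 → ℤ, ENNReal.ofReal (Torus.sobolevWeight s k ^ 2) * ‖c k‖ₑ ^ 2

/-- The pairing `⟨ρ_∞, g⟩ := ∑_n ∫ (f ∘ T_α^{-n}) g` of the series (2.7) with a test function
(junk `0` if not summable). [cite: LissMattingly2026, (2.7) p. 5 and Thm. 2.1 (1) (duality)] -/
def rhoInfPairing (α : ℝ) (f g : UnitAddTorus (Fin 2) → ℝ) : ℝ :=
  ∑' n : ℕ, ∫ z, f ((timeOneInv α)^[n] z) * g z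

/-! ## The mollified projection `P_{≤N}` of (3.3) -/

/-- An admissible bump for (3.3): `φ : ℝ² → [0,∞)` even, smooth, supported in `[-1,1]²`, `∫ φ = 1`.
[cite: LissMattingly2026, (3.3) p. 10] -/
def IsBump (φ : EuclideanSpace ℝ (Fin 2) → ℝ) : Prop :=
  ContDiff ℝ ∞ φ ∧ (∀ x, 0 ≤ φ x) ∧ (∀ x, φ (-x) = φ x) ∧
    (∀ x, φ x ≠ 0 → ∀ i, |x i| ≤ 1) ∧ ∫ x, φ x = 1

/-- `φ_N(z) = ∑_{m ∈ ℤ²} N² φ(N(z + m))`, the periodized rescaled kernel ((3.3) p. 10).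
[cite: LissMattingly2026, (3.3) p. 10 (φ_N)] -/
def bumpN (φ : EuclideanSpace ℝ (Fin 2) → ℝ) (N : ℕ) : UnitAddTorus (Fin 2) → ℝ :=
  Torus.periodize fun x => (N : ℝ) ^ 2 * φ ((N : ℝ) • x)

/-- `P_{≤N} f(z) = ∫_{𝕋²} φ_N(z - z̄) f(z̄) dz̄` ((3.3) p. 10). [cite: LissMattingly2026, (3.3) p. 10 (P_{≤N})] -/
def smoothProj (φ : EuclideanSpace ℝ (Fin 2) → ℝ) (N : ℕ) (f : UnitAddTorus (Fin 2) → ℝ) :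
    UnitAddTorus (Fin 2) → ℝ :=
  fun z => ∫ w, bumpN φ N (z - w) * f w

/-! ## Continuous time: the Duhamel solution and the limit-cycle package (module docstring 5.) -/

/-- **The unique solution of the forced transport equation (2.3)** for a `C¹` datum, by the
printed Duhamel formula `ρ(t) = ρ₀ ∘ ϕ^α_{t,0} + ∫₀ᵗ F_s ∘ ϕ^α_{t,s} ds` (p. 7), `t ≥ 0`.
[cite: LissMattingly2026, §2.2.1 p. 7 (Duhamel's formula)] -/
def solution (α : ℝ) (F : ℝ → UnitAddTorus (Fin 2) → ℝ) (ρ₀ : UnitAddTorus (Fin 2) → ℝ)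
    (t : ℝ) (z : UnitAddTorus (Fin 2)) : ℝ :=
  ρ₀ (ElgindiLissMattingly2025.flowInv (-α) t z) + ∫ s in (0 : ℝ)..t, F s (backFlow α t s z)

/-- The forcing class of Theorem 2.2: `F : [0,∞) × 𝕋² → ℝ` smooth (jointly, through the space–time
lift), time-one periodic, with `∫_{𝕋²} F(t,·) = 0` for every `t` ((2.4)).
[cite: LissMattingly2026, Thm. 2.2 p. 7 and (2.4) p. 4] -/
def IsAdmissibleForcing (F : ℝ → UnitAddTorus (Fin 2) → ℝ) : Prop :=
  Torus.IsSmoothSpaceTimeOn univ F ∧ (∀ t z, F (t + 1) z = F t z) ∧ ∀ t, ∫ z, F t z = 0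

/-- The special forcing (2.12) of Theorem 2.3: `F(t,x,y) = η(t - ⌊t⌋) h(y)` with `h ∈ C^∞(𝕋)`
mean-zero, `‖h‖_{L²(𝕋)} = 1`, and `η ∈ C^∞([0,1];[0,∞))` "a nonzero function supported in
`(1/2,1)`" — rendered: `η` smooth and nonnegative on `ℝ`, not identically zero, and vanishing off a
compact subinterval `[a,b] ⊂ (1/2,1)` (so that the time-one periodic extension `η(t - ⌊t⌋)` is smooth,
as Theorem 2.2's class requires; a possibly smaller class of forcings than a literal reading of
"supported in", hence a weakening). [cite: LissMattingly2026, Thm. 2.3 p. 7 ((2.12))] -/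
def IsShearForcing (F : ℝ → UnitAddTorus (Fin 2) → ℝ) : Prop :=
  ∃ (η : ℝ → ℝ) (h : UnitAddCircle → ℝ),
    ContDiff ℝ ∞ η ∧ (∀ t, 0 ≤ η t) ∧ (∃ t, η t ≠ 0) ∧
    (∃ a b : ℝ, 1 / 2 < a ∧ a < b ∧ b < 1 ∧ ∀ t, t ∉ Icc a b → η t = 0) ∧
    Torus.IsSmooth (fun y : UnitAddTorus (Fin 1) => h (y 0)) ∧ ∫ y, h y = 0 ∧ ∫ y, h y ^ 2 = 1 ∧
    ∀ t z, F t z = η (t - ⌊t⌋) * h (z 1)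

/-- **The limit-cycle package of Theorem 2.2** for a forcing `F`, amplitude `α` and a candidate
family of Fourier coefficients `ρinf : ℝ → (ℤ² → ℂ)`: `ρinf` is time-one periodic, bounded in every
`H^{-s}` (`s > 0`) uniformly in `t ≥ 0`, and attracts every mean-zero `C¹` datum:
`‖ρ(t) - ρ_∞(t)‖_{H^{-s}} → 0` as `t → ∞` for the Duhamel solution `ρ` (module docstring 5.; the
clause "solves (2.3)" is not transcribed). [cite: LissMattingly2026, Thm. 2.2 p. 7] -/
def IsLimitCycle (α : ℝ) (F : ℝ → UnitAddTorus (Fin 2) → ℝ) (ρinf : ℝ → (Fin 2 → ℤ) → ℂ) : Prop :=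
  (∀ t, ρinf (t + 1) = ρinf t) ∧
  (∀ s : ℝ, 0 < s → ∃ B : ℝ≥0, ∀ t : ℝ, 0 ≤ t → coeffSobolevNormSq (-s) (ρinf t) ≤ B) ∧
  ∀ ρ₀ : UnitAddTorus (Fin 2) → ℝ, Torus.IsContDiff 1 ρ₀ → ∫ z, ρ₀ z = 0 →
    ∀ s : ℝ, 0 < s →
      Tendsto (fun t : ℝ => coeffSobolevNormSq (-s) fun k => coeff (solution α F ρ₀ t) k - ρinf t k)
        atTop (𝓝 0)

/-- **The flux `T_N`** through the printed balance (2.17):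
`T_N = ∫₀¹ ⟨Π_{≤N} ρ_∞(t), F_t⟩_{L²} dt = ∫₀¹ ∑_{|k| ≤ N} Re(ρ̂_∞(t,k) conj(F̂_t(k))) dt`
(module docstring 5.). [cite: LissMattingly2026, (2.17) p. 8 (T_N)] -/
def flux (F : ℝ → UnitAddTorus (Fin 2) → ℝ) (ρinf : ℝ → (Fin 2 → ℤ) → ℂ) (N : ℕ) : ℝ :=
  ∫ t in (0 : ℝ)..1, ∑ k ∈ lowModes N, (ρinf t k * (starRingEnd ℂ) (coeff (F t) k)).re

end LissMattingly2026

open FunctionSpaces LissMattingly2026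

/-! ## §3.1: quantitative-in-`α` mixing -/

/-- **Liss–Mattingly 2026, Theorem 3.1 (Quantitative-in-`α` exponential mixing)**, verbatim p. 9:
"There exist constants `c, C > 0` such that for all `α` sufficiently large, mean-zero
`f, g ∈ W^{1,∞}(𝕋²)`, `n ∈ ℕ`, and `t ∈ [1/2 + α^{-1/2}, 1]` the following estimates hold:
`|∫ f ∘ T_α^{-n} · g| ≤ C e^{-cn log α} ‖f‖_{W^{1,∞}} ‖g‖_{W^{1,∞}}` (3.1a),
`|∫ f ∘ T_α^{-n} · g ∘ Φ^α_{0,t}| ≤ C e^{-cn log α} ‖f‖_{W^{1,∞}} ‖g‖_{W^{1,∞}}` (3.1b)."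
The constants are INDEPENDENT of `α` (quantified first); `T_α^{-n} = (timeOneInv α)^[n]`,
`Φ^α_{0,t} = flow α t`, `‖·‖_{W^{1,∞}} = eBoundedHolderNorm 1` (module docstring 1.–2.); `n` ranges
over `ℕ = {0,1,…}` (at `n = 0` the bounds hold for any `C ≥ 1`, so this costs nothing).
[cite: LissMattingly2026, Thm. 3.1 p. 9 ((3.1a)–(3.1b))] -/
def LissMattingly2026_thm31 : Prop :=
  ∃ c C : ℝ, 0 < c ∧ 0 < C ∧ ∃ α₀ : ℝ, ∀ α : ℝ, α₀ ≤ α →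
    ∀ f g : UnitAddTorus (Fin 2) → ℝ, MemBoundedHolder 1 f → MemBoundedHolder 1 g →
      ∫ z, f z = 0 → ∫ z, g z = 0 → ∀ n : ℕ,
        (|∫ z, f ((timeOneInv α)^[n] z) * g z| ≤
            C * Real.exp (-(c * n * Real.log α)) * (eBoundedHolderNorm 1 f).toReal *
              (eBoundedHolderNorm 1 g).toReal) ∧
        ∀ t ∈ Icc (1 / 2 + α ^ (-(1 / 2 : ℝ))) 1,
          (|∫ z, f ((timeOneInv α)^[n] z) * g (flow α t z)| ≤
            C * Real.exp (-(c * n * Real.log α)) * (eBoundedHolderNorm 1 f).toReal *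
              (eBoundedHolderNorm 1 g).toReal)

/-- **Liss–Mattingly 2026, Theorem 3.2 (Projected exponential mixing)**, verbatim p. 10: "There
exist constants `c, C > 0` such that for all `α` sufficiently large, mean-zero `f, g ∈ W^{1,∞}(𝕋²)`,
and `m, n ∈ ℕ` we have
`|∫ P_{≤N}(f ∘ T_α^{-n}) · P_{≤N}(g ∘ T_α^{-m})| ≤ C e^{-c|m-n| log α} ‖f‖_{W^{1,∞}} ‖g‖_{W^{1,∞}}`
(3.4) for every `N ≥ 1`", `P_{≤N}` the mollified projection (3.3) built on an admissible bump `φ`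
(`IsBump`, quantified first; module docstring 6.). [cite: LissMattingly2026, Thm. 3.2 p. 10 ((3.3)–(3.4))] -/
def LissMattingly2026_thm32 : Prop :=
  ∀ φ : EuclideanSpace ℝ (Fin 2) → ℝ, IsBump φ →
    ∃ c C : ℝ, 0 < c ∧ 0 < C ∧ ∃ α₀ : ℝ, ∀ α : ℝ, α₀ ≤ α →
      ∀ f g : UnitAddTorus (Fin 2) → ℝ, MemBoundedHolder 1 f → MemBoundedHolder 1 g →
        ∫ z, f z = 0 → ∫ z, g z = 0 → ∀ m n N : ℕ, 1 ≤ N →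
          (|∫ z, smoothProj φ N (fun w => f ((timeOneInv α)^[n] w)) z *
              smoothProj φ N (fun w => g ((timeOneInv α)^[m] w)) z| ≤
            C * Real.exp (-(c * |(m : ℝ) - n| * Real.log α)) * (eBoundedHolderNorm 1 f).toReal *
              (eBoundedHolderNorm 1 g).toReal)

/-! ## §2.1: the discrete-time model -/

/-- **Liss–Mattingly 2026, Theorem 2.1 (the cumulative Batchelor law for the discrete-time model)**,
verbatim p. 5 (module docstring *Source*), typed on Fourier coefficients (module docstring 3.–4.):
for every mean-zero `f ∈ C^∞(𝕋²)` with `‖f‖_{L²} = 1` there are `C ≥ 1` (independent of `α`) and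
`α₀` such that for all `α ≥ α₀`:
(1a) each series `ρ̂_∞(k) = ∑_n 𝓕(f ∘ T_α^{-n})(k)` is summable; (1b) `‖ρ_∞‖_{H^{-s}} < ∞` for all
`s > 0`; (1c) `∑_k |ρ̂_∞(k)|² = ∞` (`ρ_∞ ∉ L²`); (1d) `K_α(ρ_∞) = ρ_∞` by duality:
`∑_n ∫ (f ∘ T_α^{-n}) g` is summable and equals `∑_n ∫ (f ∘ T_α^{-n})(g ∘ T_α) + ∫ f g` for every
`g ∈ C¹(𝕋²)`; (2) for every mean-zero `ρ₀ ∈ C¹(𝕋²)` and `s > 0`,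
`‖K_α^n(ρ₀) - ρ_∞‖_{H^{-s}} → 0`; (3) there is `N_α ≥ 1` with
`(1/C) log N / log α ≤ ‖Π_{≤N} ρ_∞‖²_{L²} ≤ C log N / log α` for every `N ≥ N_α`.
[cite: LissMattingly2026, Thm. 2.1 p. 5 (with (2.5) p. 4, (2.7)–(2.8) p. 5)] -/
def LissMattingly2026_thm21 : Prop :=
  ∀ f : UnitAddTorus (Fin 2) → ℝ, Torus.IsSmooth f → ∫ z, f z = 0 → ∫ z, f z ^ 2 = 1 →
    ∃ C : ℝ, 1 ≤ C ∧ ∃ α₀ : ℝ, ∀ α : ℝ, α₀ ≤ α →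
      (∀ k, Summable fun n => termCoeff α f n k) ∧
      (∀ s : ℝ, 0 < s → coeffSobolevNormSq (-s) (rhoInfCoeff α f) < ⊤) ∧
      (∑' k, ‖rhoInfCoeff α f k‖ₑ ^ 2 = ⊤) ∧
      (∀ g : UnitAddTorus (Fin 2) → ℝ, Torus.IsContDiff 1 g →
        Summable (fun n : ℕ => ∫ z, f ((timeOneInv α)^[n] z) * g z) ∧
        rhoInfPairing α f g = rhoInfPairing α f (g ∘ timeOneMap α) + ∫ z, f z * g z) ∧
      (∀ ρ₀ : UnitAddTorus (Fin 2) → ℝ, Torus.IsContDiff 1 ρ₀ → ∫ z, ρ₀ z = 0 →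
        ∀ s : ℝ, 0 < s →
          Tendsto (fun n => coeffSobolevNormSq (-s) fun k => iterCoeff α f ρ₀ n k - rhoInfCoeff α f k)
            atTop (𝓝 0)) ∧
      ∃ Nα : ℕ, 1 ≤ Nα ∧ ∀ N : ℕ, Nα ≤ N →
        1 / C * (Real.log N / Real.log α) ≤ lowModeMass N (rhoInfCoeff α f) ∧
          lowModeMass N (rhoInfCoeff α f) ≤ C * (Real.log N / Real.log α)

/-! ## §2.2: continuous time -/

/-- **Liss–Mattingly 2026, Theorem 2.2 (limit cycle with an upper Batchelor bound for general
smooth periodic forcing)**, verbatim p. 7 (module docstring *Source*), typed (module docstring 5.):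
for every admissible forcing `F` (`IsAdmissibleForcing`) there is `α₀` such that for all
`α ≥ α₀` there are a time-one periodic family of coefficients `ρ_∞(t)`, bounded in every `H^{-s}`
and attracting every mean-zero `C¹` datum (`IsLimitCycle α F ρinf`), and `C_α ≥ 1` with
`‖Π_{≤N} ρ_∞(t)‖²_{L²} ≤ C_α log N` for every `t ≥ 0` and `N ≥ 2` ((2.11)).
[cite: LissMattingly2026, Thm. 2.2 p. 7 ((2.11))] -/
def LissMattingly2026_thm22 : Prop :=
  ∀ F : ℝ → UnitAddTorus (Fin 2) → ℝ, IsAdmissibleForcing F →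
    ∃ α₀ : ℝ, ∀ α : ℝ, α₀ ≤ α →
      ∃ ρinf : ℝ → (Fin 2 → ℤ) → ℂ, IsLimitCycle α F ρinf ∧
        ∃ Cα : ℝ, 1 ≤ Cα ∧ ∀ t : ℝ, 0 ≤ t → ∀ N : ℕ, 2 ≤ N →
          lowModeMass N (ρinf t) ≤ Cα * Real.log N

/-- **Liss–Mattingly 2026, Theorem 2.3 (the cumulative Batchelor law in continuous time)**,
verbatim p. 7 (module docstring *Source*), typed (module docstring 5.): for every admissible
forcing of the special form (2.12) (`IsAdmissibleForcing F ∧ IsShearForcing F`) there are `C ≥ 1`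
(independent of `α`) and `α₀` such that for all `α ≥ α₀` the limit cycle `ρ_∞` of Theorem 2.2
(`IsLimitCycle α F ρinf`) satisfies, for some `N_α ≥ 1`,
`(1/C) log N / log α ≤ ‖Π_{≤N} ρ_∞(t)‖²_{L²} ≤ C log N / log α` for all `t ≥ 0` and `N ≥ N_α`
((2.13)), and `ρ_∞(t) ∉ L²` (`∑_k |ρ̂_∞(t,k)|² = ∞`) for every `t ≥ 0`.
[cite: LissMattingly2026, Thm. 2.3 p. 7 ((2.12)–(2.13))] -/
def LissMattingly2026_thm23 : Prop :=
  ∀ F : ℝ → UnitAddTorus (Fin 2) → ℝ, IsAdmissibleForcing F → IsShearForcing F →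
    ∃ C : ℝ, 1 ≤ C ∧ ∃ α₀ : ℝ, ∀ α : ℝ, α₀ ≤ α →
      ∃ ρinf : ℝ → (Fin 2 → ℤ) → ℂ, IsLimitCycle α F ρinf ∧
        (∃ Nα : ℕ, 1 ≤ Nα ∧ ∀ t : ℝ, 0 ≤ t → ∀ N : ℕ, Nα ≤ N →
          1 / C * (Real.log N / Real.log α) ≤ lowModeMass N (ρinf t) ∧
            lowModeMass N (ρinf t) ≤ C * (Real.log N / Real.log α)) ∧
        ∀ t : ℝ, 0 ≤ t → ∑' k, ‖ρinf t k‖ₑ ^ 2 = ⊤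

/-- **Liss–Mattingly 2026, Theorem 2.4 (non-vanishing energy flux)**, verbatim p. 8: "Let `F` and
`ρ_∞` be as in Theorem 2.3. Then, the limit `lim_{N→∞} T_N` exists and is strictly positive",
`T_N = ∫₀¹ ⟨Π_{≤N} ρ_∞(t), Π_{≤N}(u_α·∇ρ_∞(t))⟩ dt = ∫₀¹ ⟨Π_{≤N} ρ_∞(t), F_t⟩ dt` ((2.17); typed
through the right member, `LissMattingly2026.flux`, module docstring 5.): for every admissible
forcing of the form (2.12) and all `α ≥ α₀`, the limit cycle `ρ_∞` (`IsLimitCycle α F ρinf`) has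
`T_N → L` for some `L > 0`. [cite: LissMattingly2026, Thm. 2.4 p. 8 ((2.17))] -/
def LissMattingly2026_thm24 : Prop :=
  ∀ F : ℝ → UnitAddTorus (Fin 2) → ℝ, IsAdmissibleForcing F → IsShearForcing F →
    ∃ α₀ : ℝ, ∀ α : ℝ, α₀ ≤ α →
      ∃ ρinf : ℝ → (Fin 2 → ℤ) → ℂ, IsLimitCycle α F ρinf ∧
        ∃ L : ℝ, 0 < L ∧ Tendsto (fun N : ℕ => flux F ρinf N) atTop (𝓝 L)

end Literature.Analysis.FluidPDE

end
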